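import Mathlib.Analysis.SpecialFunctions.Pow.Real
import Mathlib.Analysis.SpecialFunctions.Sqrt
import Mathlib.Algebra.Order.Chebyshev
import Mathlib.Data.Nat.Log

/-!
# Route FeketeSOS — crux `FeketeSOSHard` (stmt-ValiantsHypothesis-3996), line `paley-rip`,
# stub `stub_paleyFlatRIP`: level-set tools for the flat-RIP lemma (box lemma, dyadic classes)

Matrix-generic, number-theory-free tools used by `…PaleyRIPFlatToGeneral.lean` (flat 0/1 bounds ⇒
general-weight bounds for a bilinear form, the mechanism of the "flat RIP ⇒ RIP" lemma of
Bourgain–Dilworth–Ford–Konyagin–Kutzarova, Duke Math. J. 159 (2011), §3, and of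
Bandeira–Fickus–Mixon–Wong, J. Fourier Anal. Appl. 19 (2013), Thm 13), which in turn reduces the engine
`stub_paleyFlatRIP` of the line to FLAT restricted discrepancy of the Paley sum graph
(`…PaleyRIPFlatOfDiscrepancy.lean`):

* `abs_sum_mul_le_exists_subset` — BOX LEMMA: a linear functional on `[0,1]^X` is bounded by its value
  at a vertex, `|Σ_{a∈X} α_a c_a| ≤ |Σ_{a∈X'} c_a|` for some `X' ⊆ X`;
* `abs_bilin_weighted_le_of_flat` — hence a flat bound `|Σ_{A×B} M| ≤ θ√#A√#B` on all `A, B ⊆ S`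
  extends to `[0,1]`-weighted sums on `X × Y ⊆ S × S` with the bound `θ√#X√#Y`;
* `sum_filter_gt_eq_sum_classes` — DYADIC CLASSES: for `0 ≤ u ≤ N` on `S`, the part of `S` where
  `u > N/2^J` is the disjoint union of `C_j = {N/2^{j+1} < u ≤ N/2^j}`, `j < J`;
* `sum_classWeight_sq_card_le`, `sum_classWeight_sqrt_card_le` — `Σ_j (N/2^j)² #C_j ≤ 4‖u‖₂²` and, by
  Cauchy–Schwarz over the `J` classes, `Σ_j (N/2^j) √#C_j ≤ 2 √J ‖u‖₂`;
* small helpers (`le_sqrt_sum_sq`, `eq_zero_of_sum_sq_eq_zero`, `abs_bilin_le_sum_mul_sum`).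

Honest framing: elementary real-analysis bookkeeping; nothing here concerns the Paley matrix, the crux
`FeketeSOSHard`, or `VP ≠ VNP`.
-/

-- the line's namespace repeats a path segment by convention (same as the other paley-rip files)
set_option linter.dupNamespace false

namespace Summit.ValiantsHypothesis.ValiantsHypothesis.Theorems.FeketeSOSHardPaleyRIP

open Finset
open scoped BigOperators

noncomputable section

section FlatToGeneral

variable {ι : Type*}

/-- **Box lemma.** A linear functional `α ↦ Σ_{a∈X} α_a c_a` on the box `[0,1]^X` is bounded in absolute
value by its value at a vertex: `|Σ α_a c_a| ≤ |Σ_{a∈X'} c_a|` for `X'` the positive or the negative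
support of `c`. [folklore] -/
theorem abs_sum_mul_le_exists_subset (X : Finset ι) (α c : ι → ℝ) (h0 : ∀ a ∈ X, 0 ≤ α a)
    (h1 : ∀ a ∈ X, α a ≤ 1) : ∃ X' ⊆ X, |∑ a ∈ X, α a * c a| ≤ |∑ a ∈ X', c a| := by
  classical
  have hup : ∑ a ∈ X, α a * c a ≤ ∑ a ∈ X.filter (fun a => 0 < c a), c a := by
    rw [sum_filter]
    refine sum_le_sum fun a ha => ?_
    split_ifs with hc
    · nlinarith [h0 a ha, h1 a ha]
    · push Not at hc
      nlinarith [h0 a ha, h1 a ha]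
  have hlo : ∑ a ∈ X.filter (fun a => c a < 0), c a ≤ ∑ a ∈ X, α a * c a := by
    rw [sum_filter]
    refine sum_le_sum fun a ha => ?_
    split_ifs with hc
    · nlinarith [h0 a ha, h1 a ha]
    · push Not at hc
      nlinarith [h0 a ha, h1 a ha]
  by_cases hs : 0 ≤ ∑ a ∈ X, α a * c a
  · refine ⟨X.filter (fun a => 0 < c a), filter_subset _ _, ?_⟩
    rw [abs_of_nonneg hs]
    exact hup.trans (le_abs_self _)
  · refine ⟨X.filter (fun a => c a < 0), filter_subset _ _, ?_⟩
    push Not at hs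
    rw [abs_of_neg hs]
    have := neg_abs_le (∑ a ∈ X.filter (fun a => c a < 0), c a)
    linarith

/-- **Flat ⇒ box-weighted.** If `|Σ_{a∈A,b∈B} M_{ab}| ≤ θ √#A √#B` for all `A, B ⊆ S` (`θ ≥ 0`), then for
`X, Y ⊆ S` and weights `α ∈ [0,1]^X`, `β ∈ [0,1]^Y`: `|Σ_{a∈X,b∈Y} M_{ab} α_a β_b| ≤ θ √#X √#Y`
(box lemma in each variable). [folklore] -/
theorem abs_bilin_weighted_le_of_flat (S : Finset ι) (M : ι → ι → ℝ) (θ : ℝ) (hθ : 0 ≤ θ)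
    (hflat : ∀ A ⊆ S, ∀ B ⊆ S,
      |∑ a ∈ A, ∑ b ∈ B, M a b| ≤ θ * (Real.sqrt A.card * Real.sqrt B.card))
    (X Y : Finset ι) (hX : X ⊆ S) (hY : Y ⊆ S) (α β : ι → ℝ)
    (hα0 : ∀ a ∈ X, 0 ≤ α a) (hα1 : ∀ a ∈ X, α a ≤ 1) (hβ0 : ∀ b ∈ Y, 0 ≤ β b)
    (hβ1 : ∀ b ∈ Y, β b ≤ 1) :
    |∑ a ∈ X, ∑ b ∈ Y, M a b * α a * β b| ≤ θ * (Real.sqrt X.card * Real.sqrt Y.card) := by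
  have h1 : ∑ a ∈ X, ∑ b ∈ Y, M a b * α a * β b = ∑ a ∈ X, α a * ∑ b ∈ Y, M a b * β b := by
    refine sum_congr rfl fun a _ => ?_
    rw [mul_sum]
    refine sum_congr rfl fun b _ => ?_
    ring
  obtain ⟨X', hX', hb1⟩ :=
    abs_sum_mul_le_exists_subset X α (fun a => ∑ b ∈ Y, M a b * β b) hα0 hα1
  have h2 : ∑ a ∈ X', ∑ b ∈ Y, M a b * β b = ∑ b ∈ Y, β b * ∑ a ∈ X', M a b := by
    rw [sum_comm]
    refine sum_congr rfl fun b _ => ?_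
    rw [mul_sum]
    refine sum_congr rfl fun a _ => ?_
    ring
  obtain ⟨Y', hY', hb2⟩ := abs_sum_mul_le_exists_subset Y β (fun b => ∑ a ∈ X', M a b) hβ0 hβ1
  have h3 : ∑ b ∈ Y', ∑ a ∈ X', M a b = ∑ a ∈ X', ∑ b ∈ Y', M a b := sum_comm
  have h4 := hflat X' (hX'.trans hX) Y' (hY'.trans hY)
  have hmono : θ * (Real.sqrt X'.card * Real.sqrt Y'.card) ≤
      θ * (Real.sqrt X.card * Real.sqrt Y.card) := by
    apply mul_le_mul_of_nonneg_left _ hθ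
    exact mul_le_mul (Real.sqrt_le_sqrt (by exact_mod_cast card_le_card hX'))
      (Real.sqrt_le_sqrt (by exact_mod_cast card_le_card hY')) (Real.sqrt_nonneg _)
      (Real.sqrt_nonneg _)
  rw [h1]
  calc |∑ a ∈ X, α a * ∑ b ∈ Y, M a b * β b|
      ≤ |∑ a ∈ X', ∑ b ∈ Y, M a b * β b| := hb1
    _ = |∑ b ∈ Y, β b * ∑ a ∈ X', M a b| := by rw [h2]
    _ ≤ |∑ b ∈ Y', ∑ a ∈ X', M a b| := hb2
    _ = |∑ a ∈ X', ∑ b ∈ Y', M a b| := by rw [h3]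
    _ ≤ θ * (Real.sqrt X'.card * Real.sqrt Y'.card) := h4
    _ ≤ θ * (Real.sqrt X.card * Real.sqrt Y.card) := hmono

/-- Two dyadic value classes `{N/2^{j+1} < u ≤ N/2^j}` with `j ≠ k` are disjoint. [folklore] -/
theorem dyadic_class_unique {N x : ℝ} (hN : 0 < N) {j k : ℕ}
    (hj : N / 2 ^ (j + 1) < x ∧ x ≤ N / 2 ^ j) (hk : N / 2 ^ (k + 1) < x ∧ x ≤ N / 2 ^ k) : j = k := by
  by_contra hne
  rcases lt_or_gt_of_ne hne with h | h
  · have : N / 2 ^ k ≤ N / 2 ^ (j + 1) :=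
      div_le_div_of_nonneg_left hN.le (by positivity) (pow_le_pow_right₀ (by norm_num) (by omega))
    linarith [hj.1, hk.2]
  · have : N / 2 ^ j ≤ N / 2 ^ (k + 1) :=
      div_le_div_of_nonneg_left hN.le (by positivity) (pow_le_pow_right₀ (by norm_num) (by omega))
    linarith [hk.1, hj.2]

/-- **Dyadic decomposition of the large values.** For `0 ≤ u ≤ N` on `S` (`N > 0`) and `J : ℕ`, the sum of
any `f` over `{a ∈ S : u_a > N/2^J}` splits over the `J` classes `C_j = {N/2^{j+1} < u_a ≤ N/2^j}`,
`j < J`. [folklore] -/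
theorem sum_filter_gt_eq_sum_classes (S : Finset ι) (u : ι → ℝ) (N : ℝ) (hN : 0 < N)
    (hu1 : ∀ a ∈ S, u a ≤ N) (J : ℕ) (f : ι → ℝ) :
    ∑ a ∈ S.filter (fun a => N / 2 ^ J < u a), f a =
      ∑ j ∈ range J, ∑ a ∈ S.filter (fun a => N / 2 ^ (j + 1) < u a ∧ u a ≤ N / 2 ^ j), f a := by
  classical
  have hdisj : ((range J : Finset ℕ) : Set ℕ).PairwiseDisjoint
      (fun j => S.filter (fun a => N / 2 ^ (j + 1) < u a ∧ u a ≤ N / 2 ^ j)) := by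
    intro j _ k _ hjk
    simp only [Function.onFun]
    rw [disjoint_filter]
    intro a _ hj hk
    exact hjk (dyadic_class_unique hN hj hk)
  rw [← sum_biUnion hdisj]
  apply sum_congr _ (fun _ _ => rfl)
  ext a
  simp only [mem_filter, mem_biUnion, mem_range]
  constructor
  · rintro ⟨haS, hgt⟩
    have hpowJ : (0 : ℝ) < 2 ^ J := by positivity
    have hua : 0 < u a := lt_trans (div_pos hN hpowJ) hgt
    have hx1 : 1 ≤ N / u a := by rw [le_div_iff₀ hua]; linarith [hu1 a haS]
    obtain ⟨n, hn1, hn2⟩ := exists_nat_pow_near hx1 (by norm_num : (1:ℝ) < 2)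
    refine ⟨n, ?_, haS, ?_, ?_⟩
    · have hlt : N / u a < 2 ^ J := by
        rw [div_lt_iff₀ hua]
        rw [div_lt_iff₀ hpowJ] at hgt
        linarith
      have h2 : (2:ℝ) ^ n < 2 ^ J := lt_of_le_of_lt hn1 hlt
      exact (pow_lt_pow_iff_right₀ (by norm_num : (1:ℝ) < 2)).1 h2
    · rw [div_lt_iff₀ (by positivity)]
      rw [div_lt_iff₀ hua] at hn2
      linarith
    · rw [le_div_iff₀ (by positivity)]
      rw [le_div_iff₀ hua] at hn1
      linarith
  · rintro ⟨j, hj, haS, h1, _⟩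
    refine ⟨haS, lt_of_le_of_lt ?_ h1⟩
    exact div_le_div_of_nonneg_left hN.le (by positivity) (pow_le_pow_right₀ (by norm_num) (by omega))

/-- The class weights are controlled by the `ℓ²` mass: `Σ_{j<J} (N/2^j)² #C_j ≤ 4 Σ_{a∈S} u_a²`
(on `C_j`, `N/2^j < 2u_a`). [folklore] -/
theorem sum_classWeight_sq_card_le (S : Finset ι) (u : ι → ℝ) (N : ℝ) (hN : 0 < N)
    (hu1 : ∀ a ∈ S, u a ≤ N) (J : ℕ) :
    ∑ j ∈ range J, (N / 2 ^ j) ^ 2 *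
        ((S.filter (fun a => N / 2 ^ (j + 1) < u a ∧ u a ≤ N / 2 ^ j)).card : ℝ) ≤
      4 * ∑ a ∈ S, u a ^ 2 := by
  classical
  calc ∑ j ∈ range J, (N / 2 ^ j) ^ 2 *
        ((S.filter (fun a => N / 2 ^ (j + 1) < u a ∧ u a ≤ N / 2 ^ j)).card : ℝ)
      = ∑ j ∈ range J, ∑ a ∈ S.filter (fun a => N / 2 ^ (j + 1) < u a ∧ u a ≤ N / 2 ^ j),
          (N / 2 ^ j) ^ 2 := by
        refine sum_congr rfl fun j _ => ?_
        rw [sum_const, nsmul_eq_mul, mul_comm]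
    _ ≤ ∑ j ∈ range J, ∑ a ∈ S.filter (fun a => N / 2 ^ (j + 1) < u a ∧ u a ≤ N / 2 ^ j),
          4 * u a ^ 2 := by
        refine sum_le_sum fun j _ => sum_le_sum fun a ha => ?_
        obtain ⟨_, hlow, _⟩ := mem_filter.1 ha
        have hsplit : N / 2 ^ j = 2 * (N / 2 ^ (j + 1)) := by
          rw [pow_succ]; field_simp
        have hpos : 0 < N / 2 ^ (j + 1) := div_pos hN (by positivity)
        rw [hsplit]
        nlinarith
    _ = 4 * ∑ a ∈ S.filter (fun a => N / 2 ^ J < u a), u a ^ 2 := by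
        rw [sum_filter_gt_eq_sum_classes S u N hN hu1 J (fun a => u a ^ 2), mul_sum]
        refine sum_congr rfl fun j _ => ?_
        rw [mul_sum]
    _ ≤ 4 * ∑ a ∈ S, u a ^ 2 := by
        gcongr
        exact filter_subset _ _

/-- Cauchy–Schwarz over the classes: `Σ_{j<J} (N/2^j) √#C_j ≤ 2 √J · (Σ_{a∈S} u_a²)^{1/2}`. [folklore] -/
theorem sum_classWeight_sqrt_card_le (S : Finset ι) (u : ι → ℝ) (N : ℝ) (hN : 0 < N)
    (hu1 : ∀ a ∈ S, u a ≤ N) (J : ℕ) :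
    ∑ j ∈ range J, (N / 2 ^ j) *
        Real.sqrt ((S.filter (fun a => N / 2 ^ (j + 1) < u a ∧ u a ≤ N / 2 ^ j)).card : ℝ) ≤
      2 * Real.sqrt J * Real.sqrt (∑ a ∈ S, u a ^ 2) := by
  classical
  set x : ℕ → ℝ := fun j => (N / 2 ^ j) *
    Real.sqrt ((S.filter (fun a => N / 2 ^ (j + 1) < u a ∧ u a ≤ N / 2 ^ j)).card : ℝ) with hx
  have hcs := sum_mul_sq_le_sq_mul_sq (range J) (fun _ => (1:ℝ)) x
  have hone : ∑ j ∈ range J, (fun _ : ℕ => (1:ℝ)) j ^ 2 = (J : ℝ) := by simp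
  have hx2 : ∑ j ∈ range J, x j ^ 2 = ∑ j ∈ range J, (N / 2 ^ j) ^ 2 *
      ((S.filter (fun a => N / 2 ^ (j + 1) < u a ∧ u a ≤ N / 2 ^ j)).card : ℝ) := by
    refine sum_congr rfl fun j _ => ?_
    rw [hx]; dsimp only
    rw [mul_pow, Real.sq_sqrt (Nat.cast_nonneg _)]
  rw [hone, hx2] at hcs
  have hmain : (∑ j ∈ range J, x j) ^ 2 ≤ (J : ℝ) * (4 * ∑ a ∈ S, u a ^ 2) := by
    have h1 : (∑ j ∈ range J, (fun _ : ℕ => (1:ℝ)) j * x j) = ∑ j ∈ range J, x j := by simp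
    rw [h1] at hcs
    exact hcs.trans (mul_le_mul_of_nonneg_left (sum_classWeight_sq_card_le S u N hN hu1 J)
      (Nat.cast_nonneg _))
  have hxnn : 0 ≤ ∑ j ∈ range J, x j :=
    sum_nonneg fun j _ => mul_nonneg (div_nonneg hN.le (by positivity)) (Real.sqrt_nonneg _)
  have hU : 0 ≤ ∑ a ∈ S, u a ^ 2 := sum_nonneg fun a _ => sq_nonneg _
  have htarget : 0 ≤ 2 * Real.sqrt J * Real.sqrt (∑ a ∈ S, u a ^ 2) := by positivity
  have hsq : (2 * Real.sqrt J * Real.sqrt (∑ a ∈ S, u a ^ 2)) ^ 2 = (J : ℝ) * (4 * ∑ a ∈ S, u a ^ 2) := by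
    rw [mul_pow, mul_pow, Real.sq_sqrt (Nat.cast_nonneg _), Real.sq_sqrt hU]; ring
  have h2 : (∑ j ∈ range J, x j) ^ 2 ≤ (2 * Real.sqrt J * Real.sqrt (∑ a ∈ S, u a ^ 2)) ^ 2 := by
    rw [hsq]; exact hmain
  exact (pow_le_pow_iff_left₀ hxnn htarget two_ne_zero).1 h2

/-- A nonnegative vector is pointwise bounded by its `ℓ²` norm on `S`. [folklore] -/
theorem le_sqrt_sum_sq (S : Finset ι) (u : ι → ℝ) (hu0 : ∀ a ∈ S, 0 ≤ u a) {a : ι} (ha : a ∈ S) :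
    u a ≤ Real.sqrt (∑ b ∈ S, u b ^ 2) := by
  have h : u a ^ 2 ≤ ∑ b ∈ S, u b ^ 2 := single_le_sum (f := fun b => u b ^ 2) (fun b _ => sq_nonneg _) ha
  exact (Real.le_sqrt (hu0 a ha) (sum_nonneg fun b _ => sq_nonneg _)).2 h

/-- If the `ℓ²` mass of a nonnegative vector on `S` vanishes, the vector vanishes on `S`. [folklore] -/
theorem eq_zero_of_sum_sq_eq_zero (S : Finset ι) (u : ι → ℝ) (h : ∑ b ∈ S, u b ^ 2 = 0) {a : ι}
    (ha : a ∈ S) : u a = 0 := by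
  have := (sum_eq_zero_iff_of_nonneg (fun b _ => sq_nonneg (u b))).1 h a ha
  exact (pow_eq_zero_iff two_ne_zero).1 this

/-- Trivial bound for a block of the bilinear form with `|M| ≤ 1` and nonnegative weights:
`|Σ_{a∈X,b∈Y} M_{ab} u_a v_b| ≤ (Σ_{a∈X} u_a)(Σ_{b∈Y} v_b)`. [folklore] -/
theorem abs_bilin_le_sum_mul_sum (M : ι → ι → ℝ) (hM : ∀ a b, |M a b| ≤ 1) (X Y : Finset ι)
    (u v : ι → ℝ) (hu : ∀ a ∈ X, 0 ≤ u a) (hv : ∀ b ∈ Y, 0 ≤ v b) :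
    |∑ a ∈ X, ∑ b ∈ Y, M a b * u a * v b| ≤ (∑ a ∈ X, u a) * ∑ b ∈ Y, v b := by
  rw [sum_mul_sum]
  refine (abs_sum_le_sum_abs _ _).trans (sum_le_sum fun a ha => ?_)
  refine (abs_sum_le_sum_abs _ _).trans (sum_le_sum fun b hb => ?_)
  rw [abs_mul, abs_mul, abs_of_nonneg (hu a ha), abs_of_nonneg (hv b hb)]
  have := hM a b
  have hua := hu a ha
  have hvb := hv b hb
  calc |M a b| * u a * v b ≤ 1 * u a * v b := by gcongr
    _ = u a * v b := by ring

end FlatToGeneral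

end

end Summit.ValiantsHypothesis.ValiantsHypothesis.Theorems.FeketeSOSHardPaleyRIP
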